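import Literature.AlgebraicGeometry.HodgeTheory.SemiregularVariationalHodgeTwistedPerfect
import Literature.AlgebraicGeometry.HodgeTheory.MotivatedClasses
import Literature.AlgebraicGeometry.Motives.HyperbolicWeilType
import HarnessLib

/-!
# Markman's secant QUOTIENT anchor carries a pinned twisted carrier of Weil shape (OBJECT-level form of arXiv:2502.03415 at the anchor)

Family `hodge`, layer `Literature/AlgebraicGeometry/HodgeTheory`. Requested by road b02
(`Summits/HodgeConjecture/HodgeConjecture/Theses/VHCAbelianSchemesRoad.lean`, crux stmt-HodgeConjecture-19787, the `(6, 3)` rung;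
director-hodge g6/g7 rulings 2026-08-27 «(a′) anchor carrier, per variety, citation — ONE [claim]-tagged PREPRINT def»). Two declarations:

* `HasSecantCarrierWeilAnchor C Adm d` (a PREDICATE, real definition): the OBJECT-level twin of the class-level anchor predicate
  `HasLocallyAlgebraicWeilAnchor 3 d` (`WeilClassesLocalAnchor.lean`). There are complex abelian sixfolds `P`, `Y`, an endomorphism
  `ψ₀` of `P` with `ψ₀ ≫ ψ₀ = -d`, a homomorphism `q : P ⟶ Y` inducing isomorphisms on complex cohomology in every degree, a
  polarisation class `h ∈ H²(Y(ℂ); ℂ)` (`IsPolarizationClass`: rational, supported on a divisor, hard Lefschetz) such that `(P, ψ₀)` is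
  of HYPERBOLIC Weil type for `q^*h` (`Motives.IsHyperbolicWeilType`, van Geemen's `det H = (-1)ⁿ`), and a RATIONAL class `γ ∈ H⁶(Y(ℂ); ℂ)`
  OFF the ray `ℂ·h³` whose pull-back `q^*γ` lies in the Weil plane `weilClassesOf P ψ₀ 3 d`, such that ON EVERY COPY `e : X' ≅ Y` of the
  scheme `Y` there is a member `(I ∋ 3, κ)` of the object class `twistedReflexiveClass C Adm 6 X'` of `B`-twisted `Adm`-admissible bounded
  complexes of vector bundles (`SemiregularVariationalHodgeTwistedPerfect.lean`, definition item D1 of the road) whose classes are PINNED to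
  `(e^*h, e^*γ)`: `κ₃ = e^*γ + c₃·(e^*h)³` and `κ_k = c_k·(e^*h)^k` for `k ∈ I`, `k ≠ 3`. This is EXACTLY the per-variety input of the road's
  served-fibre partition (`Summits/…/Theorems/VHCAbelianSchemesRoadServedFibreDefs.lean`, `AnchoredCarrierAt`): a carrier with Bloch's shape
  `a·w + b·l₀ᵖ` and every side component on the polarisation ray.
* `Markman2025_secantQuotientAnchor_twistedCarrier_sixfold C Adm` (NAMED CLAIM-FACT, source UNREFEREED):
  `∀ d, Even d → 4 ≤ d → HasSecantCarrierWeilAnchor C Adm d` — what Markman's construction establishes AT the quotient anchor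
  `Y = (X × X̂)/Ḡ` BEFORE any deformation argument; see "Source" and "Rendering" below. SCHEMA in the admissibility notion `Adm` exactly like
  the road's door fact `TwistedPerfectDoorVHC C Adm` (same file as D1): faithful for the INTENDED notion and every weaker one (below); users take
  `(h : Markman2025_secantQuotientAnchor_twistedCarrier_sixfold C Adm)` at the `Adm` of their door.

## Source, verbatim (held text `paper:arxiv-2502.03415`, E. Markman, *Cycles on abelian 2n-folds of Weil type from secant sheaves on
## abelian n-folds*, arXiv:2502.03415 v2, UNREFEREED — tagged `[claim …]`; corpus numbering in brackets where it differs)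

§1.3 (p. 5): "the subspace `H²(X × X̂, ℚ)^{Spin(V)_P}` is one-dimensional spanned by an ample class `h` […] `(X × X̂, η, h)` is a polarized
abelian variety of Weil type." Cor. 1.3.2: "If the rank `r` of a `P`-secant^{⊠2}-object `E := Φ(F₁ ⊠ F₂^∨)` is non zero, then its
characteristic class `κ(E)` is `Spin(V)_P`-invariant". Thm. 1.4.1 (p. 6; `X = Pic²(C)`, `C` a genus-3 non-hyperelliptic curve,
`F₁ = 𝓘_{∪C_i}(Θ)`, `F₂ = 𝓘_{∪Σ_i}(Θ)`, `d + 1` generic translates, `u := √-d Θ`, `d ≥ 3`, `K = ℚ(√-d)`): "• The dual object `Φ(F₂ ⊠ F₁)^∨`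
is isomorphic to `𝓔[-2]`, where `𝓔` is a simple reflexive sheaf of rank `8d` over `X × X̂` […] • The `η(K)`-translates of the graded summand
`κ₃(𝓔)` of `κ(𝓔)` in `H^{3,3}(X × X̂, ℚ)`, together with `h³`, span the 3-dimensional subspace `ℚh³ ⊕ ĤW_P`". Cor. 4.0.4 [corpus 4.0.7]:
"The subring `(∧^*(V_ℚ))^{Spin(V)_P}` consists of the direct sum of the rational 2-dimensional subspace of Hodge-Weil classes in
`∧^{2n}(V_ℚ)^{Spin(V)_P}` and the space of powers of classes in the one-dimensional `∧²(V_ℚ)^{Spin(V)_P}`". Lemma 3.1.3: "the discriminant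
of the hermitian form `H` is `(-1)ⁿ`." §1.5 (p. 7): "The sheaf `𝓔` in the theorem is not semiregular. […] Let `q : X × X̂ → Y := (X × X̂)/Ḡ`
be the quotient morphism. When `d` is even [footnote: If `d` is odd replace it with `4d` and note that `ℚ(√-4d) = ℚ(√-d)`.] the rank `8d` of
`𝓔` is relatively prime to the order `(d+1)²` of `Ḡ`. In that case we can replace `𝓔` by its tensor product with a suitable power of the line
bundle `det(𝓔)` to get a `Ḡ`-equivariant sheaf `𝓔̃`. The latter descends to a semiregular reflexive sheaf `𝓔̄` over `Y` satisfying
`q^*𝓔̄ = 𝓔̃`. Finally, we associate to `𝓔̄` a reflexive sheaf `𝓑`, twisted by a Čech 2-cocycle with coefficients in `μ_{8d}` and with a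
trivial determinant line bundle, satisfying `κ(𝓔) = q^*κ(𝓑)`." Lemma 9.3.4/9.3.5 with footnote (p. 71): "If `d` is even [Note that
`ℚ(√-d) = ℚ(√-4d)`, so the assumption that `d` is even does not restrict the complex multiplications we can treat] then the object `𝒢 ⊗ Dᵃ`
admits a `Ḡ`-linearization." Remark 9.3.7: "If `d` is even, then the Brauer class of `𝓑` […] is trivial, since `(𝒢 ⊗ Dᵃ, λ ⊗ (∧ʳλ)ᵃ)`
descends to an object in `D^b(Y)`, whose derived dual `𝓔̄` is represented by an untwisted reflexive sheaf […] In this case `𝓑` can be chosen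
to be associated to `𝓔̄` via Construction [twisted sheaf with trivial determinant associated to a coherent sheaf]." §9.3 after Lemma 9.3.6:
"`q^*at_𝓑 = at_𝓔 - (c₁(𝓔)/r)·id_𝓔` […] `q^*κ(𝓑) = ch(𝓔)exp(-c₁(𝓔)/r)`". Lemma 9.3.11: "The twisted reflexive sheaf `𝓑` is semiregular."
Proof of Lemma 9.3.11 (p. 74): "the arrows labeled `q^*` are all isomorphisms."

## Rendering of the claim-fact (what is asserted, witness, and what is RENDERING GLUE)

REGIME: `d` EVEN, `d ≥ 4` ONLY (Thm. 1.4.1 needs `d ≥ 3`; the untwisted descent `𝓔̄` needs `d` even, Lemma 9.3.5 / Remark 9.3.7). For such `d`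
the witness is literally Markman's; NO statement is made for other `d` (consumers needing only the field `K = ℚ(√-d)` instantiate at `4d`,
Markman's footnote; no isogeny transport is asserted here — cf. referee G17 on the class-level file).

Witness (`d` even, `d ≥ 4`): `P := X × X̂`, `ψ₀ := η(√-d) = φ_d` (`φ_d² = -d`), `Y := (X × X̂)/Ḡ` (an abelian sixfold: quotient of an
abelian variety by a finite subgroup of translations), `q` the quotient isogeny (a homomorphism; `q^*` an isomorphism on `H^*(–, ℚ)`, "the
arrows labeled `q^*` are all isomorphisms"), `h := (q^*)⁻¹(h_P)` with `h_P` Markman's `Spin(V)_P`-invariant ample class (`h` is ample on `Y`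
since `q` is finite and `q^*h = h_P` is ample; rational and supported on a divisor; hard Lefschetz for an ample class, Voisin I Thm. 6.25 —
so `IsPolarizationClass 6 Y h`); `(P, ψ₀)` is of hyperbolic Weil type for `q^*h = h_P` (Lemma 3.1.3, `det H = (-1)³`, van Geemen's dictionary
recorded in `Motives/HyperbolicWeilType`; the predicate is insensitive to `h ↦ c·h`, exactly as used in `WeilClassesLocalAnchor`). The datum:
`E• :=` a finite locally free resolution of the untwisted reflexive sheaf `𝓔̄` on `Y` (smooth projective), `B₀ := -c₁(𝓔̄)/8d` (rational;
algebraic = the class of the divisor `det 𝓔̄`), `I := {1, …, 6}`, `κ_k := (exp(B₀) ∪ ch(E•))_k = κ_k(𝓔̄) = κ_k(𝓑)` (`𝓑 = 𝓔̄ ⊗ det^{-1/8d}`,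
Remark 9.3.7), and `q^*κ(𝓑) = κ(𝓔)` is `Spin(V)_P`-invariant (Cor. 1.3.2), hence (Cor. 4.0.4) `κ_k(𝓔) = c_k·h_Pᵏ` for `k ≠ 3` and
`κ₃(𝓔) = c₃·h_P³ + w₀`, `w₀ ∈ ĤW_P = weilClassesOf P ψ₀ 3 d` rational, `w₀ ≠ 0` (Thm. 1.4.1 4th item: the `η(K)`-translates of `h³` are
multiples of `h³`), so `w₀ ∉ ℂ·h_P³` (`ψ₀^*` acts on `ĤW_P` by `(±i√d)⁶ = -d³` and on `h_P³` by `+d³`); pulling back along the isomorphism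
`q^*`: `γ := (q^*)⁻¹ w₀`, `κ₃ = γ + c₃·h³`, `κ_k = c_k·hᵏ`. ON EVERY COPY `e : X' ≅ Y`: the same construction transported along `e` (the
anchor is an isomorphism class of varieties; the class-level file quantifies over charts `e' : P.X ≅ 𝒳_{s₀}` in the same way).

ADMISSIBILITY (the schema parameter): print gives "`𝓔̄` semiregular" (§1.5) / "`𝓑` semiregular" (Lemma 9.3.11; the two are equivalent, the
semiregularity maps differing by the unipotent factor `exp(-c₁/r) ∪`, eq. after Lemma 9.3.6), i.e. the Buchweitz–Flenner map
`σ = (σ_q)_q : Ext²(𝓔̄, 𝓔̄) → ⊕ H^{q+2}(Y, Ω^q)` is INJECTIVE. The INTENDED `Adm` is «`(σ_q(E•))_{q+1 ∈ I}` jointly injective on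
`Ext²_{D(Y)}(E•, E•)` and `Ext^{<0}(E•, E•) = 0`» (the venture's `gluableSigmaAdmissible`, which a Literature file cannot import; with
`I = {1, …, 6}` all of `σ₀, …, σ₄` are included, so joint injectivity IS semiregularity). RENDERING GLUE (standard, not sentences of [Mar25]):
(g1) the semiregularity map of the strictly perfect complex `E• ≃ 𝓔̄[0]` is that of the sheaf `𝓔̄` (Buchweitz–Flenner define `σ` in `D(Y)`);
(g2) `Ext^{k}(E•, E•) = Ext^{k}(𝓔̄, 𝓔̄) = 0` for `k < 0` (a sheaf); (g3) `q^*` bijective on complex cohomology for an isogeny; (g4) ampleness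
/ hard Lefschetz of the descended class `h`. The claim is FAITHFUL for every `Adm` implied by the intended one on such `E•` (in particular
for the road's `AdmTw := gluableSigmaAdmissible ∨ bfSingleAdmissible`); it OVER-REACHES print for any `Adm` demanding a LOCALLY FREE sheaf
in degree `0` alone (`bfSingleAdmissible` by itself: `𝓔̄` is reflexive, locally free only off the surface `Θ̃`, Prop. 9.2.2) or simplicity
data not in print — do not instantiate it there. A consumer's theorem is exactly as strong as the notion it is fed (D1's contract).

So the fact asserts, per even `d ≥ 4`, ONE object-level statement at ONE (isomorphism class of) polarized sixfold; it says nothing about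
other members of the Weil-type component (where print gives ALGEBRAICITY of the transported class by deformation + Baire, not a carrier),
nothing about `X × X̂` itself (whose secant sheaf `𝓔` is NOT semiregular), and nothing about sums of carriers or other directions of
`ℚh³ ⊕ ĤW` (one plane `ℚh³ ⊕ ℚγ` per construction). It is NOT implied by, and does not imply, the class-level
`Markman2025_secantAnchor_locallyAlgebraic_sixfold` on current carriers (object ⟹ class needs the twisted door's variational statement
`TwistedPerfectDoorVHC`, a separate named fact).

## References

* [Markman2025SecantWeil] E. Markman, arXiv:2502.03415 v2 (2025): §1.3, Cor. 1.3.2, Thm. 1.4.1, §1.5, Lemma 3.1.3, Cor. 4.0.4 (corpus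
  "4.0.7"), Prop. 9.2.2, Lemma 9.3.4–9.3.6, Remark 9.3.7, Lemma 9.3.11 and its proof. UNREFEREED.
* [BuchweitzFlenner2003] R.-O. Buchweitz, H. Flenner, Compositio Math. 137 (2003), Def. 4.1 and §5 (the semiregularity map in `D(Y)`).
* [Perry2026Semiregularity] arXiv:2604.00511, Thm. 1.1 (the `(E₀, B₀)` packaging of a twisted sheaf with trivial determinant; D1).
* [vanGeemen1994HodgeAV] B. van Geemen, LNM 1594 (1994), Lemma 5.2, 5.4 (hyperbolic = `det H = (-1)ⁿ`).
* [VoisinHodgeI2002] C. Voisin, Hodge Theory and Complex Algebraic Geometry I, Thm. 6.25 (hard Lefschetz for an ample class).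
-/

noncomputable section

open CategoryTheory

namespace Literature.AlgebraicGeometry.HodgeTheory

open Literature.AlgebraicTopology.SingularHomology

section HodgeTheory

/-- **A secant-carrier Weil anchor in dimension `6` for `K = ℚ(√-d)`, for the Chern character `C` and the admissibility notion `Adm`.**
There are complex abelian varieties `P`, `Y` of dimension `6`, `ψ₀ : P ⟶ P` with `ψ₀ ≫ ψ₀ = -(d • 𝟙 P)`, a homomorphism `q : P ⟶ Y`
inducing BIJECTIONS `q^* : Hᵏ(Y(ℂ); ℂ) → Hᵏ(P(ℂ); ℂ)` in every degree (an isogeny on cohomology), a polarisation class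
`h ∈ H²(Y(ℂ); ℂ)` (`IsPolarizationClass 6 Y h`) with `(P, ψ₀)` of HYPERBOLIC Weil type for `q^*h`, and a RATIONAL class `γ ∈ H⁶(Y(ℂ); ℂ)`
with `γ ∉ ℂ·h³` and `q^*γ ∈ weilClassesOf P ψ₀ 3 d` (a non-Lefschetz-ray class whose pull-back is a Weil class), such that on EVERY copy
`e : X' ≅ Y` of the scheme `Y` there are degrees `I ∋ 3`, classes `κ` in the object class `twistedReflexiveClass C Adm 6 X' I` (a
`B`-twisted `Adm`-admissible bounded complex of vector bundles on `X'`) and scalars `c_k` with `κ₃ = e^*γ + c₃·(e^*h)³` and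
`κ_k = c_k·(e^*h)ᵏ` for `k ∈ I`, `k ≠ 3` (a PINNED carrier: Bloch's `a·z₀ + b·l₀ᵖ`, all side components on the polarisation ray). The
object-level twin of `HasLocallyAlgebraicWeilAnchor 3 d` (module docstring); a plain predicate, no statement by itself.
[cite: Bloch1972Semiregularity, Remark (7.5)] [cite: Markman2025SecantWeil, §1.5 and Cor. 4.0.4] -/
def HasSecantCarrierWeilAnchor (C : ChernCharacterBetti) (Adm : PerfectAdmissibility) (d : ℕ) : Prop :=
  ∃ (P Y : Motives.AbelianVariety ℂ) (ψ₀ : P ⟶ P) (q : P ⟶ Y) (h : complexBetti Y.X 2) (γ : complexBetti Y.X (2 * 3)),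
    P.dim = 6 ∧ Y.dim = 6 ∧ ψ₀ ≫ ψ₀ = -(d • 𝟙 P) ∧
    (∀ k : ℕ, Function.Bijective (complexBetti.map q.hom.hom.hom k)) ∧
    IsPolarizationClass 6 Y.X h ∧
    Motives.IsHyperbolicWeilType P ψ₀ 3 (complexBetti.map q.hom.hom.hom 2 h) ∧
    IsRationalClass γ ∧ γ ∉ (ℂ ∙ cupPowTwo h 3) ∧
    complexBetti.map q.hom.hom.hom (2 * 3) γ ∈ weilClassesOf P ψ₀ 3 d ∧
    ∀ (X' : Motives.SchemeOver ℂ) (e : X' ≅ Y.X),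
      ∃ (I : Finset ℕ) (κ : (k : ℕ) → complexBetti X' (2 * k)) (c : ℕ → ℂ),
        3 ∈ I ∧ twistedReflexiveClass C Adm 6 X' I κ ∧
        κ 3 = complexBetti.map e.hom (2 * 3) γ + c 3 • cupPowTwo (complexBetti.map e.hom 2 h) 3 ∧
        ∀ k ∈ I, k ≠ 3 → κ k = c k • cupPowTwo (complexBetti.map e.hom 2 h) k

/-- **Markman 2025 (arXiv:2502.03415, UNREFEREED), the OBJECT-level statement at the secant QUOTIENT anchor: for every EVEN `d ≥ 4`
the quotient `Y = (X × X̂)/Ḡ` of the split `ℚ(√-d)`-Weil sixfold `X × X̂` (`X = Pic²(C)`, `C` a generic non-hyperelliptic genus-3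
curve; `Ḡ ≅ (ℤ/(d+1))²`), polarised by the descent `h` of the `Spin(V)_P`-invariant ample class, carries — on every copy — the
`B`-twisted `Adm`-admissible datum `(E• = ` a locally free resolution of the descended semiregular reflexive sheaf `𝓔̄`, `B₀ = -c₁(𝓔̄)/8d,
I = {1,…,6})` whose classes `κ = κ(𝓔̄) = κ(𝓑)` are `c_k·hᵏ` off degree `3` and `γ + c₃·h³` in degree `3`, `γ = (q^*)⁻¹ w₀` the (non-zero,
rational) Weil component of `κ₃(𝓔)`** — §1.5 ("descends to a semiregular reflexive sheaf `𝓔̄` over `Y`"; "`κ(𝓔) = q^*κ(𝓑)`"), Remark 9.3.7,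
Lemma 9.3.11, Cor. 1.3.2 + Cor. 4.0.4 [corpus 4.0.7] (shape of `κ`), Thm. 1.4.1 (4th item: `w₀ ≠ 0`), Lemma 3.1.3 (hyperbolic). Witness,
regime (`d` even `≥ 4` ONLY — no `d ↦ 4d` transport asserted), the `Adm`-schema contract (INTENDED: full semiregularity of `E• ≃ 𝓔̄[0]` +
`Ext^{<0} = 0`; faithful for every weaker notion, e.g. the road's `gluableSigmaAdmissible ∨ bfSingleAdmissible`; over-reaching for notions
demanding a vector bundle in degree `0`) and the rendering glue (g1)–(g4): module docstring. PREPRINT — UNREFEREED wherever load-bearing.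
Users take `(h : Markman2025_secantQuotientAnchor_twistedCarrier_sixfold C Adm)`.
[claim: Markman2025SecantWeil, status: under-review] -/
def Markman2025_secantQuotientAnchor_twistedCarrier_sixfold (C : ChernCharacterBetti) (Adm : PerfectAdmissibility) : Prop :=
  ∀ d : ℕ, Even d → 4 ≤ d → HasSecantCarrierWeilAnchor C Adm d

end HodgeTheory

end Literature.AlgebraicGeometry.HodgeTheory

end
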